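import Literature.NumberTheory.EllipticCurves.HeegnerPointsClassGroupProofs
import Mathlib.NumberTheory.NumberField.InfinitePlace.Embeddings
import HarnessLib

/-!
# Heegner forms and ideal classes, II: forms with equivalent ideals are `Γ₀(N)`-equivalent

Companion (theorems only) to `Literature.NumberTheory.EllipticCurves.HeegnerPoints`, second of
three files proving the named fact
`Literature.NumberTheory.EllipticCurves.HeegnerDatum.card_reps_eq_classNumber` (Gross 1984, §I.1;
Gross–Kohnen–Zagier 1987, §I.1). With an integral basis `(1, ω)` of `𝓞 K`, `ω² = m + tω`,
`d_K = t² + 4m < 0`, and the ideal `𝔞_Q = (A, ω − k)`, `k = (B + t)/2`, of a Heegner form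
`Q = (A, B, C)` (`FormIdeals.lean`, `HeegnerPointsClassGroupProofs.lean`), we prove the
**injectivity** of `[Q] ↦ [𝔞_Q]` on `Γ₀(N)`-classes of Heegner forms of level `N` with
`B ≡ β (mod 2N)`:

* `exists_embedding_basis_one_eq`: a complex embedding `σ : K → ℂ` with
  `σ(ω) = (t + i√|d_K|)/2` (i.e. `σ(√d_K) = i√|d_K|`);
* `coe_heegnerTau_eq_div`: under it, `τ_Q = σ(ω − k)/A` (the root of `AX² + BX + C` in `ℍ`,
  `eq_heegnerTau_of_isRoot`);
* `dvd_entry_of_level` (the level): if `Q = Q' ∘ M` for `M = (p q; r s) ∈ SL₂(ℤ)` with `N ∣ A`,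
  `N ∣ A'`, `B ≡ B' (mod 2N)` and `Q'` primitive, then `N ∣ r`, i.e. `M ∈ Γ₀(N)`;
* `isGamma0Equiv_of_span_mul_formIdeal_eq`: if `(x) 𝔞_Q = (y) 𝔞_{Q'}` with `x, y ≠ 0` (same
  ideal class, Mathlib `ClassGroup.mk0_eq_mk0_iff`) for Heegner forms `Q, Q'` of level `N`,
  discriminant `d_K`, `B ≡ B' (mod 2N)`, then `Q` and `Q'` are `Γ₀(N)`-equivalent
  (`IsGamma0Equiv N Q Q'`): the two lattice bases differ by an integral matrix `M` with
  `M M' = 1`, the embedding turns `λ(A, ω − k) = (A', ω − k')` into `τ_Q = M · τ_{Q'}`,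
  orientation forces `det M = 1` (`det_eq_one_of_moebius_eq`), `τ` determines the form
  (`heegnerForm_eq_of_heegnerTau_eq`, `sl2_smul_heegnerTau`), and the level condition gives `M ∈ Γ₀(N)`
  (Gross–Kohnen–Zagier 1987, §I.1, p. 505: the map `Q_{N,β,D}/Γ₀(N) → Cl` is injective; Cox,
  Thm. 7.7(ii) for `N = 1`).

## References

* B. H. Gross, *Heegner points on `X₀(N)`*, in *Modular Forms* (Durham 1983), Horwood (1984),
  87–105, §I.1.
* B. Gross, W. Kohnen, D. Zagier, *Heegner points and derivatives of `L`-series. II*, Math. Ann.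
  278 (1987), 497–562, §I.1.
* D. A. Cox, *Primes of the form x² + ny²*, 2nd ed., Wiley (2013), §7.B, Thm. 7.7.
-/

noncomputable section

open scoped MatrixGroups

open Module NumberField CongruenceSubgroup UpperHalfPlane
open Literature.NumberTheory.QuadraticFields.Quadratic

namespace Literature.NumberTheory.EllipticCurves

/-! ### A complex embedding with `σ(√d_K) = i√|d_K|` -/

/-- A complex square root of a negative real number is purely imaginary: if `z² = D < 0` then
`Re z = 0` and `(Im z)² = −D`. [folklore] -/
theorem re_eq_zero_and_im_sq_eq_of_sq_eq {z : ℂ} {D : ℝ} (hD : D < 0) (h : z ^ 2 = (D : ℂ)) :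
    z.re = 0 ∧ z.im ^ 2 = -D := by
  have hre := congrArg Complex.re h
  have him := congrArg Complex.im h
  simp only [pow_two, Complex.mul_re, Complex.mul_im, Complex.ofReal_re, Complex.ofReal_im] at hre him
  have h2 : z.re * z.im = 0 := by linarith
  rcases mul_eq_zero.mp h2 with h0 | h0
  · refine ⟨h0, ?_⟩
    rw [h0] at hre
    nlinarith
  · exfalso
    rw [h0] at hre
    nlinarith [sq_nonneg z.re]

section Embedding

variable {K : Type*} [Field K] [NumberField K]

/-- **An embedding sending `ω` to the upper half-plane.** For an integral basis `(1, ω)` of the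
imaginary quadratic field `K`, `ω² = m + tω`, `t² + 4m < 0`, there is a complex embedding
`σ : K → ℂ` with `σ(ω) = (t + i√(−(t² + 4m)))/2`, i.e. `σ(2ω − t) = σ(√d_K) = i√|d_K|` (one of
the two conjugate embeddings of `K`; Mathlib `NumberField.ComplexEmbedding.conjugate`).
[folklore] -/
theorem exists_embedding_basis_one_eq (b : Basis (Fin 2) ℤ (𝓞 K)) {t m : ℤ}
    (hω : b 1 * b 1 = (m : 𝓞 K) + (t : 𝓞 K) * b 1) (hneg : t ^ 2 + 4 * m < 0) :
    ∃ σ : K →+* ℂ, σ ((b 1 : 𝓞 K) : K) =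
      ((t : ℂ) + Complex.I * (√(-(t ^ 2 + 4 * m : ℝ)) : ℂ)) / 2 := by
  obtain ⟨φ⟩ : Nonempty (K →+* ℂ) := inferInstance
  set ψ : 𝓞 K →+* ℂ := φ.comp (algebraMap (𝓞 K) K) with hψ
  set w : ℂ := ψ (b 1) with hw
  have hww : w * w = (m : ℂ) + (t : ℂ) * w := by
    have h := congrArg ψ hω
    rw [map_mul, map_add, map_mul, map_intCast, map_intCast] at h
    exact h
  set z : ℂ := 2 * w - t with hz
  have hnegR : (t ^ 2 + 4 * m : ℝ) < 0 := by
    have : ((t ^ 2 + 4 * m : ℤ) : ℝ) < 0 := by exact_mod_cast hneg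
    push_cast at this
    exact this
  have hz2 : z ^ 2 = ((t ^ 2 + 4 * m : ℝ) : ℂ) := by
    push_cast
    rw [hz]
    linear_combination 4 * hww
  obtain ⟨hzre, hzim⟩ := re_eq_zero_and_im_sq_eq_of_sq_eq hnegR hz2
  set S : ℝ := √(-(t ^ 2 + 4 * m : ℝ)) with hS
  have hS2 : z.im = S ∨ z.im = -S := by
    apply sq_eq_sq_iff_eq_or_eq_neg.mp
    rw [hzim, hS, Real.sq_sqrt (by linarith)]
  have hwz : w = (z + t) / 2 := by rw [hz]; ring
  rcases hS2 with h | h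
  · refine ⟨φ, ?_⟩
    have hzI : z = Complex.I * S := Complex.ext (by simp [hzre]) (by simp [h])
    change ψ (b 1) = _
    rw [← hw, hwz, hzI]
    ring
  · refine ⟨NumberField.ComplexEmbedding.conjugate φ, ?_⟩
    have hzI : (starRingEnd ℂ) z = Complex.I * S :=
      Complex.ext (by simp [hzre]) (by simp [h])
    rw [NumberField.ComplexEmbedding.conjugate_coe_eq]
    change (starRingEnd ℂ) (ψ (b 1)) = _
    rw [← hw, hwz, map_div₀, map_add, hzI, map_intCast, map_ofNat]
    ring

omit [NumberField K] in
/-- **`τ_Q` through the embedding.** For `σ` as in `exists_embedding_basis_one_eq` (restricted to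
`𝓞 K`) and a positive definite form `(A, B, C)` of discriminant `t² + 4m`, the Heegner point is
`τ_Q = σ(ω − k)/A`, `k = (B + t)/2`: indeed `σ(ω − k) = (−B + i√|D|)/2`, a root of
`AX² + BX + C` in `ℍ` (`eq_heegnerTau_of_isRoot`; Gross–Kohnen–Zagier 1987, §I.1:
`τ_Q = (−B + √D)/2A`). [folklore] -/
theorem coe_heegnerTau_eq_div (b : Basis (Fin 2) ℤ (𝓞 K)) {t m : ℤ}
    (hω : b 1 * b 1 = (m : 𝓞 K) + (t : 𝓞 K) * b 1) (hneg : t ^ 2 + 4 * m < 0) {ψ : 𝓞 K →+* ℂ}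
    (hψ : ψ (b 1) = ((t : ℂ) + Complex.I * (√(-(t ^ 2 + 4 * m : ℝ)) : ℂ)) / 2)
    {A B C : ℤ} (hA : 0 < A) (hdisc : B ^ 2 - 4 * A * C = t ^ 2 + 4 * m) :
    (heegnerTau (A, B, C) : ℂ) = ψ (b 1 - (((B + t) / 2 : ℤ) : 𝓞 K)) / A := by
  have hD : B ^ 2 - 4 * A * C < 0 := hdisc ▸ hneg
  set k : ℤ := (B + t) / 2 with hk
  have h2k : 2 * k = B + t := two_mul_ediv_two_of_disc_eq hdisc
  have hn : A * C = k ^ 2 - t * k - m := norm_eq_of_disc_eq hdisc h2k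
  set S : ℝ := √(-(t ^ 2 + 4 * m : ℝ)) with hS
  have hnegR : (t ^ 2 + 4 * m : ℝ) < 0 := by
    have : ((t ^ 2 + 4 * m : ℤ) : ℝ) < 0 := by exact_mod_cast hneg
    push_cast at this
    exact this
  have hSpos : 0 < S := Real.sqrt_pos.mpr (by linarith)
  set E : ℂ := ψ (b 1 - (k : 𝓞 K)) with hEdef
  have hE : E = ((t : ℂ) + Complex.I * S) / 2 - k := by
    rw [hEdef, map_sub, map_intCast, hψ]
  have hA0 : (A : ℂ) ≠ 0 := by exact_mod_cast hA.ne'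
  have him : (E / A).im = S / 2 / A := by
    rw [hE, Complex.div_intCast_im]
    simp
  have hpos : 0 < (E / A).im := by
    rw [him]
    have : (0 : ℝ) < A := by exact_mod_cast hA
    positivity
  -- the root equation
  have hηη := sub_mul_sub_eq b hω k
  have hroot : (A : ℂ) * (E / A) ^ 2 + B * (E / A) + C = 0 := by
    have h1 := congrArg ψ hηη
    simp only [map_mul, map_sub, map_intCast] at h1
    push_cast at h1
    have hEW : E = ψ (b 1) - k := by rw [hEdef, map_sub, map_intCast]
    have key : (A : ℂ) * (E / A) ^ 2 + B * (E / A) + C = (E * E + B * E + A * C) / A := by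
      field_simp
    rw [key, div_eq_zero_iff]
    left
    have hB : (B : ℂ) = 2 * k - t := by exact_mod_cast (by linarith : B = 2 * k - t)
    have hn' : (A : ℂ) * C = (k : ℂ) ^ 2 - t * k - m := by exact_mod_cast hn
    rw [hEW]
    linear_combination h1 + (ψ (b 1) - k) * hB + hn'
  set τ₀ : ℍ := ⟨E / A, hpos⟩ with hτ₀
  have hτ := eq_heegnerTau_of_isRoot (Q := (A, B, C)) hA hD τ₀ hroot
  rw [← hτ]

end Embedding

/-! ### The level: `N ∣ r` -/

/-- **The level condition.** Let `M = (p q; r s)`, `ps − qr = 1`, and let `Q' = (A', B', C')` be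
primitive with `N ∣ A'`. If the form `Q = Q' ∘ M⁻ᵀ`-image with `A = A's² − B'sr + C'r²`,
`B = −2A'qs + B'(ps + qr) − 2C'pr` (the form with `M · τ_{Q'} = τ_Q`, `sl2_smul_heegnerTau`)
also has `N ∣ A` and `B ≡ B' (mod 2N)`, then `N ∣ r`, i.e. `M ∈ Γ₀(N)`: modulo `N' = N/gcd(N, r)`
one gets `C'r ≡ B's`, `B'q ≡ C'p`, whence `N' ∣ B', C', A'` and `N' = 1` by primitivity
(Gross–Kohnen–Zagier 1987, §I.1, p. 505, injectivity of `Q_{N,β,D}/Γ₀(N) → Q_D/Γ(1)`).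
[folklore] -/
theorem dvd_entry_of_level {N A' B' C' p q r s : ℤ} (hdet : p * s - q * r = 1)
    (hprim : ∀ d : ℤ, d ∣ A' → d ∣ B' → d ∣ C' → IsUnit d) (hNA' : N ∣ A')
    (hNA : N ∣ A' * s ^ 2 - B' * s * r + C' * r ^ 2)
    (hNB : 2 * N ∣ -(2 * A' * q * s) + B' * (p * s + q * r) - 2 * C' * p * r - B') : N ∣ r := by
  have h1 : N ∣ r * (C' * r - B' * s) := by
    have : r * (C' * r - B' * s) = (A' * s ^ 2 - B' * s * r + C' * r ^ 2) - s ^ 2 * A' := by ring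
    rw [this]
    exact dvd_sub hNA (dvd_mul_of_dvd_right hNA' _)
  have h2 : N ∣ r * (B' * q - C' * p) := by
    have h2N : 2 * N ∣ 2 * (r * (B' * q - C' * p) - q * s * A') := by
      have : 2 * (r * (B' * q - C' * p) - q * s * A') =
          -(2 * A' * q * s) + B' * (p * s + q * r) - 2 * C' * p * r - B' := by
        linear_combination (-B') * hdet
      rw [this]
      exact hNB
    have h3 : N ∣ r * (B' * q - C' * p) - q * s * A' := (mul_dvd_mul_iff_left two_ne_zero).mp h2N
    have : r * (B' * q - C' * p) = (r * (B' * q - C' * p) - q * s * A') + q * s * A' := by ring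
    rw [this]
    exact dvd_add h3 (dvd_mul_of_dvd_right hNA' _)
  -- split off `g = gcd(N, r)`
  rcases Nat.eq_zero_or_pos (Int.gcd N r) with hg0 | hgpos
  · obtain ⟨rfl, rfl⟩ := Int.gcd_eq_zero_iff.mp hg0
    exact dvd_rfl
  obtain ⟨g, N₁, r₁, hg, hco, hN, hr⟩ := Int.exists_gcd_one' hgpos
  have hg0 : (g : ℤ) ≠ 0 := by exact_mod_cast hg.ne'
  -- `N₁ ∣ C'r - B's` and `N₁ ∣ B'q - C'p`
  have h1' : N₁ ∣ C' * r - B' * s := by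
    have h : N₁ * g ∣ r₁ * g * (C' * r - B' * s) := by rw [← hN, ← hr]; exact h1
    rw [mul_comm r₁, mul_assoc, mul_comm N₁] at h
    exact Int.dvd_of_dvd_mul_right_of_gcd_one ((mul_dvd_mul_iff_left hg0).mp h) hco
  have h2' : N₁ ∣ B' * q - C' * p := by
    have h : N₁ * g ∣ r₁ * g * (B' * q - C' * p) := by rw [← hN, ← hr]; exact h2
    rw [mul_comm r₁, mul_assoc, mul_comm N₁] at h
    exact Int.dvd_of_dvd_mul_right_of_gcd_one ((mul_dvd_mul_iff_left hg0).mp h) hco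
  -- hence `N₁ ∣ A', B', C'`, so `N₁ = ±1`
  have hB' : N₁ ∣ B' := by
    have : B' = -(p * (C' * r - B' * s) + r * (B' * q - C' * p)) := by
      linear_combination (-B') * hdet
    rw [this]
    exact (dvd_add (dvd_mul_of_dvd_right h1' _) (dvd_mul_of_dvd_right h2' _)).neg_right
  have hC' : N₁ ∣ C' := by
    have : C' = -(q * (C' * r - B' * s) + s * (B' * q - C' * p)) := by
      linear_combination (-C') * hdet
    rw [this]
    exact (dvd_add (dvd_mul_of_dvd_right h1' _) (dvd_mul_of_dvd_right h2' _)).neg_right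
  have hA' : N₁ ∣ A' := (Dvd.intro _ hN.symm).trans hNA'
  have hu : IsUnit N₁ := hprim N₁ hA' hB' hC'
  rcases Int.isUnit_iff.mp hu with h | h
  · rw [hN, hr, h, one_mul]
    exact Dvd.intro r₁ (mul_comm _ _)
  · rw [hN, hr, h]
    exact ⟨-r₁, by ring⟩

/-! ### Injectivity: equivalent ideals come from `Γ₀(N)`-equivalent forms -/

/-- **Injectivity of `[Q] ↦ [𝔞_Q]`** (Gross 1984, §I.1; Gross–Kohnen–Zagier 1987, §I.1, p. 505;
Cox, Thm. 7.7(ii) for `N = 1`). Let `(1, ω)` be an integral basis of `K`, `ω² = m + tω`,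
`t² + 4m < 0`, and let `Q = (A, B, C)`, `Q' = (A', B', C')` be Heegner forms of level `N` and
discriminant `t² + 4m = d_K` (`heegnerForms`) with `B ≡ B' (mod 2N)`. If `(x) 𝔞_Q = (y) 𝔞_{Q'}`
for `x, y ∈ 𝓞 K`, `x ≠ 0` (`𝔞_Q = (A, ω − (B + t)/2)`), then `Q` and `Q'` are `Γ₀(N)`-equivalent.
Proof: comparing the lattices `x(ℤA ⊕ ℤη) = y(ℤA' ⊕ ℤη')` gives integral matrices `M = (p q; r s)`,
`M'` with `MM' = 1`; a complex embedding with `σ(√d_K) = i√|d_K|` turns this into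
`τ_Q = M · τ_{Q'}` (`coe_heegnerTau_eq_div`), so `det M = 1` (`det_eq_one_of_moebius_eq`),
`Q = Q' ∘ M⁻¹` (`sl2_smul_heegnerTau`, `heegnerForm_eq_of_heegnerTau_eq`) and `M ∈ Γ₀(N)`
(`dvd_entry_of_level`). [cite: Gross1984, §I.1] -/
theorem isGamma0Equiv_of_span_mul_formIdeal_eq {K : Type*} [Field K] [NumberField K]
    (b : Basis (Fin 2) ℤ (𝓞 K)) (hb : b 0 = 1) {t m : ℤ}
    (hω : b 1 * b 1 = (m : 𝓞 K) + (t : 𝓞 K) * b 1) (hneg : t ^ 2 + 4 * m < 0) {N : ℕ}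
    {Q Q' : ℤ × ℤ × ℤ} (hQ : Q ∈ heegnerForms N (t ^ 2 + 4 * m))
    (hQ' : Q' ∈ heegnerForms N (t ^ 2 + 4 * m)) (hBB' : Q.2.1 ≡ Q'.2.1 [ZMOD 2 * N])
    {x y : 𝓞 K} (hx : x ≠ 0)
    (h : Ideal.span {x} * Ideal.span {(Q.1 : 𝓞 K), b 1 - (((Q.2.1 + t) / 2 : ℤ) : 𝓞 K)} =
      Ideal.span {y} * Ideal.span {(Q'.1 : 𝓞 K), b 1 - (((Q'.2.1 + t) / 2 : ℤ) : 𝓞 K)}) :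
    IsGamma0Equiv N Q Q' := by
  obtain ⟨A, B, C⟩ := Q
  obtain ⟨A', B', C'⟩ := Q'
  obtain ⟨hdisc, hA, hNA, hprim⟩ := hQ
  obtain ⟨hdisc', hA', hNA', hprim'⟩ := hQ'
  dsimp only at hdisc hA hNA hprim hdisc' hA' hNA' hprim' hBB' h ⊢
  have hD : B ^ 2 - 4 * A * C < 0 := hdisc ▸ hneg
  have hD' : B' ^ 2 - 4 * A' * C' < 0 := hdisc' ▸ hneg
  set k : ℤ := (B + t) / 2 with hk
  set k' : ℤ := (B' + t) / 2 with hk'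
  have h2k : 2 * k = B + t := two_mul_ediv_two_of_disc_eq hdisc
  have h2k' : 2 * k' = B' + t := two_mul_ediv_two_of_disc_eq hdisc'
  have hn : A * C = k ^ 2 - t * k - m := norm_eq_of_disc_eq hdisc h2k
  have hn' : A' * C' = k' ^ 2 - t * k' - m := norm_eq_of_disc_eq hdisc' h2k'
  set η : 𝓞 K := b 1 - k with hη
  set η' : 𝓞 K := b 1 - k' with hη'
  -- Step 1: the change-of-basis matrices
  have hmem1 : ∀ z ∈ Ideal.span {x} * Ideal.span {(A : 𝓞 K), η},
      ∃ u v : ℤ, z = y * (u * A' + v * η') := by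
    intro z hz
    rw [h] at hz
    obtain ⟨w, hw, rfl⟩ := Ideal.mem_span_singleton_mul.mp hz
    obtain ⟨u, v, rfl⟩ := (mem_span_pair_iff_of_basis b hb hω hn' w).mp hw
    exact ⟨u, v, rfl⟩
  have hmem2 : ∀ z ∈ Ideal.span {y} * Ideal.span {(A' : 𝓞 K), η'},
      ∃ u v : ℤ, z = x * (u * A + v * η) := by
    intro z hz
    rw [← h] at hz
    obtain ⟨w, hw, rfl⟩ := Ideal.mem_span_singleton_mul.mp hz
    obtain ⟨u, v, rfl⟩ := (mem_span_pair_iff_of_basis b hb hω hn w).mp hw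
    exact ⟨u, v, rfl⟩
  have gen₁ : ∀ (z w₁ w₂ : 𝓞 K), z * w₁ ∈ Ideal.span {z} * Ideal.span {w₁, w₂} := fun z w₁ w₂ ↦
    Ideal.mul_mem_mul (Ideal.mem_span_singleton_self z) (Ideal.subset_span (by simp))
  have gen₂ : ∀ (z w₁ w₂ : 𝓞 K), z * w₂ ∈ Ideal.span {z} * Ideal.span {w₁, w₂} := fun z w₁ w₂ ↦
    Ideal.mul_mem_mul (Ideal.mem_span_singleton_self z) (Ideal.subset_span (by simp))
  obtain ⟨q, p, hpq⟩ := hmem1 _ (gen₂ x (A : 𝓞 K) η)       -- `x η = y (q A' + p η')`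
  obtain ⟨s, r, hrs⟩ := hmem1 _ (gen₁ x (A : 𝓞 K) η)       -- `x A = y (s A' + r η')`
  obtain ⟨q', p', hpq'⟩ := hmem2 _ (gen₂ y (A' : 𝓞 K) η')  -- `y η' = x (q' A + p' η)`
  obtain ⟨s', r', hrs'⟩ := hmem2 _ (gen₁ y (A' : 𝓞 K) η')  -- `y A' = x (s' A + r' η)`
  -- `M M' = 1`
  have hrow1 : q * s' + p * q' = 0 ∧ q * r' + p * p' = 1 := by
    have e : x * η = x * (((q * s' + p * q' : ℤ) : 𝓞 K) * A + ((q * r' + p * p' : ℤ) : 𝓞 K) * η) := by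
      calc x * η = y * (q * A' + p * η') := hpq
        _ = q * (y * A') + p * (y * η') := by ring
        _ = q * (x * (s' * A + r' * η)) + p * (x * (q' * A + p' * η)) := by rw [hrs', hpq']
        _ = _ := by push_cast; ring
    have e' := mul_left_cancel₀ hx e
    have e'' : (((0 : ℤ) : 𝓞 K)) * A + ((1 : ℤ) : 𝓞 K) * (b 1 - k) =
        ((q * s' + p * q' : ℤ) : 𝓞 K) * A + ((q * r' + p * p' : ℤ) : 𝓞 K) * (b 1 - k) := by
      rw [← hη]
      push_cast at e' ⊢
      linear_combination e'
    obtain ⟨h1, h2⟩ := lattice_coords_unique b hb hA.ne' e''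
    exact ⟨h1.symm, h2.symm⟩
  have hrow2 : s * s' + r * q' = 1 ∧ s * r' + r * p' = 0 := by
    have e : x * A = x * (((s * s' + r * q' : ℤ) : 𝓞 K) * A + ((s * r' + r * p' : ℤ) : 𝓞 K) * η) := by
      calc x * A = y * (s * A' + r * η') := hrs
        _ = s * (y * A') + r * (y * η') := by ring
        _ = s * (x * (s' * A + r' * η)) + r * (x * (q' * A + p' * η)) := by rw [hrs', hpq']
        _ = _ := by push_cast; ring
    have e' := mul_left_cancel₀ hx e
    have e'' : (((1 : ℤ) : 𝓞 K)) * A + ((0 : ℤ) : 𝓞 K) * (b 1 - k) =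
        ((s * s' + r * q' : ℤ) : 𝓞 K) * A + ((s * r' + r * p' : ℤ) : 𝓞 K) * (b 1 - k) := by
      rw [← hη]
      push_cast at e' ⊢
      linear_combination e'
    obtain ⟨h1, h2⟩ := lattice_coords_unique b hb hA.ne' e''
    exact ⟨h1.symm, h2.symm⟩
  have hdet : p * s - q * r = 1 ∨ p * s - q * r = -1 := by
    apply Int.eq_one_or_neg_one_of_mul_eq_one (v := p' * s' - q' * r')
    obtain ⟨h1, h2⟩ := hrow1
    obtain ⟨h3, h4⟩ := hrow2
    linear_combination (s * s' + r * q') * h2 + h3 - (s * r' + r * p') * h1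
  -- Step 2: into `ℂ`; `τ_Q = M · τ_{Q'}`
  obtain ⟨σ, hσ⟩ := exists_embedding_basis_one_eq b hω hneg
  set ψ : 𝓞 K →+* ℂ := σ.comp (algebraMap (𝓞 K) K) with hψdef
  have hψ : ψ (b 1) = ((t : ℂ) + Complex.I * (√(-(t ^ 2 + 4 * m : ℝ)) : ℂ)) / 2 := hσ
  have hτ : (heegnerTau (A, B, C) : ℂ) = ψ η / A := coe_heegnerTau_eq_div b hω hneg hψ hA hdisc
  have hτ' : (heegnerTau (A', B', C') : ℂ) = ψ η' / A' :=
    coe_heegnerTau_eq_div b hω hneg hψ hA' hdisc'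
  have hX : ψ x ≠ 0 := by
    rw [hψdef, RingHom.comp_apply, map_ne_zero]
    exact RingOfIntegers.coe_ne_zero_iff.mpr hx
  have hE : ψ x * ψ η = ψ y * (q * A' + p * ψ η') := by
    have h1 := congrArg ψ hpq
    simpa only [map_mul, map_add, map_intCast] using h1
  have hAe : ψ x * A = ψ y * (s * A' + r * ψ η') := by
    have h1 := congrArg ψ hrs
    simpa only [map_mul, map_add, map_intCast] using h1
  have hA0 : (A : ℂ) ≠ 0 := by exact_mod_cast hA.ne'
  have hA0' : (A' : ℂ) ≠ 0 := by exact_mod_cast hA'.ne'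
  have hmob : (heegnerTau (A, B, C) : ℂ) * ((r : ℂ) * heegnerTau (A', B', C') + s) =
      (p : ℂ) * heegnerTau (A', B', C') + q := by
    rw [hτ, hτ']
    have key : ψ η / A * ((r : ℂ) * (ψ η' / A') + s) - ((p : ℂ) * (ψ η' / A') + q) =
        (1 / (ψ x * A * A')) *
          ((ψ x * ψ η) * (r * ψ η' + s * A') - (ψ x * A) * (p * ψ η' + q * A')) := by
      field_simp
    have hbr : (ψ x * ψ η) * (r * ψ η' + s * A') - (ψ x * A) * (p * ψ η' + q * A') = 0 := by
      rw [hE, hAe]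
      ring
    rw [hbr, mul_zero, sub_eq_zero] at key
    exact key
  have hdet1 : p * s - q * r = 1 := det_eq_one_of_moebius_eq hmob hdet
  -- the matrix `M ∈ SL₂(ℤ)` with `M · τ_{Q'} = τ_Q`
  let M : SL(2, ℤ) := ⟨!![p, q; r, s], by rw [Matrix.det_fin_two_of]; linarith⟩
  have h00 : M 0 0 = p := rfl
  have h01 : M 0 1 = q := rfl
  have h10 : M 1 0 = r := rfl
  have h11 : M 1 1 = s := rfl
  have hden : (r : ℂ) * heegnerTau (A', B', C') + s ≠ 0 := by
    have h := sl2z_denom_ne_zero M (heegnerTau (A', B', C'))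
    rwa [h10, h11] at h
  have hMsmul : M • heegnerTau (A', B', C') = heegnerTau (A, B, C) := by
    apply UpperHalfPlane.ext
    rw [coe_specialLinearGroup_apply, h00, h01, h10, h11]
    simp only [eq_intCast, Complex.ofReal_intCast]
    rw [div_eq_iff hden, ← hmob]
  -- Step 3: `Q = Q' ∘ M⁻¹`
  have hsm := sl2_smul_heegnerTau M hA' hD'
  rw [hMsmul, h00, h01, h10, h11] at hsm
  have hpos'' : 0 < A' * s ^ 2 - B' * s * r + C' * r ^ 2 := by
    have hp := sl2_act_fst_pos M hA' hD'
    rw [h10, h11] at hp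
    exact hp
  have hdisc'' : B ^ 2 - 4 * A * C = (-(2 * A' * q * s) + B' * (p * s + q * r) - 2 * C' * p * r) ^ 2 -
      4 * (A' * s ^ 2 - B' * s * r + C' * r ^ 2) * (A' * q ^ 2 - B' * p * q + C' * p ^ 2) := by
    have hd := sl2_act_disc M A' B' C'
    rw [h00, h01, h10, h11] at hd
    rw [hd, hdisc, hdisc']
  have hQQ := heegnerForm_eq_of_heegnerTau_eq (Q := (A, B, C)) (Q' := (_, _, _)) hA hD hpos'' hdisc'' hsm
  simp only [Prod.mk.injEq] at hQQ
  obtain ⟨hA1, hB1, -⟩ := hQQ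
  -- Step 4: the level, `M ∈ Γ₀(N)`
  have hNr : (N : ℤ) ∣ r := by
    refine dvd_entry_of_level hdet1 hprim' hNA' (hA1 ▸ hNA) ?_
    rw [← hB1]
    exact hBB'.symm.dvd
  have hM : M ∈ Gamma0 N := by
    rw [Gamma0_mem, h10]
    exact (ZMod.intCast_zmod_eq_zero_iff_dvd r N).mpr hNr
  refine ⟨⟨M, hM⟩⁻¹, ?_⟩
  rw [← hMsmul, Subgroup.smul_def, Subgroup.coe_inv, inv_smul_smul]

end Literature.NumberTheory.EllipticCurves

end
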